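import Literature.AlgebraicGeometry.Frobenioids.KummerReciprocity
import HarnessLib

/-!
# Frobenioids II, Definition 2.2 (ii): the universal closure of the named property `Kummer.FNIsCyclic`
# ("`F_N(A) ≅ ℤ/Nℤ` [NSW, Thm 7.2.6]") is REFUTED — PROOF-ONLY

Mochizuki, *The geometry of Frobenioids II*, Kyushu J. Math. **62** (2008) 401–460, §2, Definition
2.2 (ii) pp. 17–18 [cite: MochizukiFrdII2008, Def 2.2 (ii) p.18]: "— so
`F_N(A) ≅ H²(H, μ_N(A)) ≅ ℤ/Nℤ` [cf., e.g., [NSW], Chapter 7, Theorem 7.2.6]".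

`KummerReciprocity.lean` (abc-iut-L1-t7) records the second isomorphism as the PROPERTY
`Kummer.FNIsCyclic N O H_A q := Nonempty (F_N(A) ≃+ ℤ/Nℤ)` of ARBITRARY data (a group `Γ` acting
on a commutative monoid `O`, a subgroup `H_A ≤ Γ`, a continuous homomorphism `q : H → H_A`), "not
asserted here"; FACT-LIST row F-1388 of the abc-iut cell lists it as a bindable named fact. This
file records the kernel event that classifies the row: as a property of arbitrary data its
universal closure is FALSE (`Kummer.not_forall_fnIsCyclic`). Witness: the degenerate data
`Γ = H = H_A = 1`, `O = 1` (so `μ_N(A) = 1`), `N = 2` — then every continuous cochain module of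
`H_A` with coefficients in `μ_2(A) = 1` is trivial, so `H²(H_A, μ_2(A)) = 0`, `F_2(A) = 0`, which is
not isomorphic to `ℤ/2ℤ`. The general lemma behind it, `subsingleton_continuousCohomology` (the
continuous cohomology of a representation on a trivial module vanishes in every degree), is proved
from Mathlib's definition (homology of the homogeneous cochain complex).

The printed setting is NOT degenerate: AT THE GALOIS BINDING over a non-archimedean local field of
characteristic `0` the property is DISCHARGED in the tree
(`PadicKummer.Def22Context.nonempty_fn_equiv_zmod_ofGalois`, `PadicKummer.fnIsCyclic_of_isAddCyclic`,
file `PadicKummerGaloisFN.lean`, from the Brauer-group computation `|H²(G_E, μ_N)| = N`, cyclic). So the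
row is a hypothesis ON DATA, true at the named instance and false in general (R5: admissible at named
instances only). Nothing here concerns [IUTchIII]; no statement of the paper is contradicted — the
paper asserts the isomorphism only for the `p`-adic Frobenioid's data.
-/

namespace Literature.AlgebraicGeometry.Frobenioids

namespace Kummer

open CategoryTheory

section Vanishing

variable {k G : Type} [Ring k] [TopologicalSpace k] [Group G] [TopologicalSpace G]
  [IsTopologicalGroup G]

/-- Every term `M, C(G, M), C(G, C(G, M)), …` of the standard resolution of a topological
representation on a trivial (one-element) module is trivial. [cite: MochizukiFrdII2008, Def 2.2 (ii) p.17] -/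
theorem subsingleton_resolutionX (X : TopRep.{0} k G) [Subsingleton X.V] :
    ∀ n, Subsingleton (TopRep.resolutionX X n).V
  | 0 => ‹_›
  | n + 1 => by
    haveI := subsingleton_resolutionX X n
    change Subsingleton C(G, (TopRep.resolutionX X n).V)
    infer_instance

/-- A topological module with one element is a zero object of `TopModuleCat`.
[cite: MochizukiFrdII2008, Def 2.2 (ii) p.17] -/
theorem isZero_of_subsingleton (M : TopModuleCat.{0} k) [Subsingleton M] : Limits.IsZero M := by
  refine ⟨fun Z => ⟨⟨⟨0⟩, fun f => ?_⟩⟩, fun Z => ⟨⟨⟨0⟩, fun f => ?_⟩⟩⟩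
  · ext x
    rw [Subsingleton.elim x 0, map_zero, map_zero]
  · ext x
    exact Subsingleton.elim _ _

/-- **Continuous cohomology with coefficients in a trivial module vanishes**: if the underlying
module of `X` has one element, then `Hⁿ(G, X)` (Mathlib's `continuousCohomology`, the homology of the
homogeneous cochain complex) has one element, for every `n`. Used for the coefficient module
`μ_N(A)` when `μ_N(A) = 1`. [cite: MochizukiFrdII2008, Def 2.2 (ii) p.17] -/
theorem subsingleton_continuousCohomology (X : TopRep.{0} k G) [Subsingleton X.V] (n : ℕ) :
    Subsingleton (continuousCohomology n X) := by
  haveI : Subsingleton ((TopRep.homogeneousCochains X).X n) := by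
    haveI := subsingleton_resolutionX X (n + 1)
    change Subsingleton ((TopRep.resolutionX X (n + 1)).ρ.invariants)
    infer_instance
  have hZ : Limits.IsZero ((TopRep.homogeneousCochains X).X n) := isZero_of_subsingleton _
  have hH : Limits.IsZero (continuousCohomology n X) :=
    ShortComplex.isZero_homology_of_isZero_X₂ (S := (TopRep.homogeneousCochains X).sc n) hZ
  have h1 : (𝟙 (continuousCohomology n X) : _ ⟶ _) = 0 := hH.eq_of_src _ _
  have h0 : ∀ a : continuousCohomology n X, a = 0 := fun a => by
    simpa using
      congrArg (fun f : continuousCohomology n X ⟶ continuousCohomology n X => f.hom a) h1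
  exact ⟨fun a b => by rw [h0 a, h0 b]⟩

end Vanishing

/-- `μ_N` of the one-element monoid is trivial. [cite: MochizukiFrdII2008, Def 2.1 (i) p.16] -/
theorem subsingleton_mu_punit (N : ℕ) : Subsingleton (Mu N PUnit.{1}) :=
  ⟨fun _ _ => Mu.ext (Subsingleton.elim _ _)⟩

/-- For the one-element monoid `O = 1` (any `Γ`, `H_A`, `q`), `F_N(A)` is trivial:
`H²(H_A, μ_N(A)) = 0` since `μ_N(A) = 1`. [cite: MochizukiFrdII2008, Def 2.2 (ii) p.17] -/
theorem subsingleton_fn_punit {Γ : Type} [Group Γ] [TopologicalSpace Γ] [DiscreteTopology Γ]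
    [MulDistribMulAction Γ PUnit.{1}] (N : ℕ) (HA : Subgroup Γ) {H : Type} [Group H]
    [TopologicalSpace H] [IsTopologicalGroup H] (q : H →ₜ* HA) :
    Subsingleton (FN N PUnit.{1} HA q) := by
  haveI : Subsingleton (muTopRep N PUnit.{1} HA).V := by
    change Subsingleton (Additive (Mu N PUnit.{1}))
    haveI := subsingleton_mu_punit N
    infer_instance
  haveI := subsingleton_continuousCohomology (muTopRep N PUnit.{1} HA) 2
  exact Quot.Subsingleton

/-- **F-1388: the universal closure of `Kummer.FNIsCyclic` is FALSE.** As a property of ARBITRARY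
data `(Γ ↷ O, H_A ≤ Γ, q : H → H_A, N)` the printed isomorphism "`F_N(A) ≅ ℤ/Nℤ` [NSW, Thm 7.2.6]"
fails: for `Γ = H = 1`, `O = 1`, `N = 2` one has `F_2(A) = 0 ≇ ℤ/2ℤ`. (At the Galois binding of the
paper's setting it HOLDS: `PadicKummer.Def22Context.nonempty_fn_equiv_zmod_ofGalois`.) The row is a
hypothesis on data, admissible at named instances only. [cite: MochizukiFrdII2008, Def 2.2 (ii) p.18] -/
theorem not_forall_fnIsCyclic :
    ¬ ∀ (Γ : Type) [Group Γ] (N : ℕ) (O : Type) [CommMonoid O] [MulDistribMulAction Γ O]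
        (HA : Subgroup Γ) [TopologicalSpace Γ] [DiscreteTopology Γ] (H : Type) [Group H]
        [TopologicalSpace H] [IsTopologicalGroup H] (q : H →ₜ* HA),
        Literature.AlgebraicGeometry.Frobenioids.Kummer.FNIsCyclic N O HA q := by
  intro h
  obtain ⟨e⟩ := h PUnit.{1} 2 PUnit.{1} ⊤ PUnit.{1} 1
  haveI := subsingleton_fn_punit (Γ := PUnit.{1}) 2 ⊤ (1 : PUnit.{1} →ₜ* (⊤ : Subgroup PUnit.{1}))
  haveI : Subsingleton (ZMod 2) := e.symm.injective.subsingleton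
  exact absurd (Subsingleton.elim (0 : ZMod 2) 1) (by decide)

end Kummer

end Literature.AlgebraicGeometry.Frobenioids
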